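import Mathlib
import Literature.Combinatorics.Additive.TripleProductProperty
import Literature.Combinatorics.Additive.TripleProductPropertySAT
import Summits.MatrixMultiplication.MatrixMultiplication.Theorems.SnSubsetDichotomyPolynomialSlackStubRelativeMixing

/-!
# Coset fibring of TPP triples and the heredity `P(S_{n-1})·n ≤ P(S_n) ≤ κ·P(S_{n-1})`

Crux `Summit.MatrixMultiplication.MatrixMultiplication.Theses.SnSubsetDichotomy.PolynomialSlack`
(item `stmt-MatrixMultiplication-8306`), helper file of lead c3 (line `transport-split-hull`): the two
elementary inequalities behind an INDUCTION ON `n` for TPP volumes in `S_n`.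

* `card_mul_mul_le_fibres` — bookkeeping: if every triple of fibres `(S ∩ f⁻¹a, T ∩ g⁻¹b, U ∩ h⁻¹c)` has
  volume `≤ B`, then `|S||T||U| ≤ |f(S)|·|g(T)|·|h(U)|·B`.
* `tpp_card_mul_mul_le_cosets` — COSET FIBRING: for a subgroup `K` and a labelling `ℓ` whose fibres lie
  in right cosets of `K` (`ℓ x = ℓ y → x y⁻¹ ∈ K`), every TPP triple satisfies
  `|S||T||U| ≤ m_S m_T m_U · B` where `m_X = |ℓ(X)|` is the number of right `K`-cosets met by `X` and `B`
  bounds the volume of TPP triples INSIDE `K` (sub-triples of a TPP triple are TPP, and a fibre inside one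
  right coset translates into `K` by `TripleProductProperty.map_mulRight`).
* `tpp_extend` — EXTENSION: a TPP triple inside `K` stays TPP when `U` is replaced by `U·R` for any set `R`
  of pairwise `K`-inequivalent elements (`r r'⁻¹ ∈ K → r = r'`), and `|U·R| = |U||R|`.
* In `S_n` with `K = Stab(i₀)` (`ℓ x = x⁻¹ i₀`, right cosets = fibres of `x ↦ x⁻¹ i₀`):
  `tpp_card_mul_mul_le_pointFibres` — `|S||T||U| ≤ |S⁻¹i₀|·|T⁻¹i₀|·|U⁻¹i₀| · B` for any bound `B` on TPP
  volumes in `S_{n-1}` (transport `Stab(i₀) ≅ S_{n-1}` by `exists_stabiliser_transport`), and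
  `tpp_volume_lift` — a TPP triple of `S_{n-1}` of volume `V` gives one of `S_n` of volume `n·V`
  (transversal `{swap i₀ k}`).

So with `P(n) := max |S||T||U|` over TPP triples of `S_n`: `n·P(n-1) ≤ P(n) ≤ κ·P(n-1)`,
`κ = min_{i₀} |S⁻¹i₀||T⁻¹i₀||U⁻¹i₀|` for an extremal triple; the neutral rate is `n^{3/2}`, so
`PolynomialSlack` follows from any "pinched point" theorem `κ ≤ n^{3/2}/ω(1)` for large triples (see the
crux notes of lead c3). UNCONDITIONAL, valid in every group where stated so.
-/

namespace Summit.MatrixMultiplication.MatrixMultiplication.Theorems.PolynomialSlack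

open scoped BigOperators
open Finset
open Literature.Combinatorics.Additive (TripleProductProperty)

set_option linter.dupNamespace false

/-! ## Bookkeeping: volumes are sums over fibres -/

/-- **Fibre bookkeeping.** If every triple of fibres of `f, g, h` on `S, T, U` has volume at most `B`,
then `|S||T||U| ≤ |f(S)|·|g(T)|·|h(U)|·B` (write each cardinality as the sum of its fibre
cardinalities and expand the product). [folklore] -/
theorem card_mul_mul_le_fibres {G α β γ : Type*} [DecidableEq α] [DecidableEq β] [DecidableEq γ]
    (S T U : Finset G) (f : G → α) (g : G → β) (h : G → γ) (B : ℕ)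
    (hB : ∀ a ∈ S.image f, ∀ b ∈ T.image g, ∀ c ∈ U.image h,
      (S.filter (fun x => f x = a)).card * (T.filter (fun x => g x = b)).card *
        (U.filter (fun x => h x = c)).card ≤ B) :
    S.card * T.card * U.card ≤ (S.image f).card * (T.image g).card * (U.image h).card * B := by
  rw [card_eq_sum_card_image f S, card_eq_sum_card_image g T, card_eq_sum_card_image h U,
    sum_mul_sum, sum_mul]
  simp_rw [sum_mul_sum]
  calc ∑ a ∈ S.image f, ∑ b ∈ T.image g, ∑ c ∈ U.image h,
        (S.filter (fun x => f x = a)).card * (T.filter (fun x => g x = b)).card *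
          (U.filter (fun x => h x = c)).card
      ≤ ∑ _a ∈ S.image f, ∑ _b ∈ T.image g, ∑ _c ∈ U.image h, B := by
        gcongr with a ha b hb c hc
        exact hB a ha b hb c hc
    _ = (S.image f).card * (T.image g).card * (U.image h).card * B := by
        simp only [sum_const, smul_eq_mul]; ring

/-! ## Coset fibring in a group -/

variable {G : Type*} [Group G] [DecidableEq G]

omit [DecidableEq G] in
/-- A fibre of a labelling whose fibres lie in right `K`-cosets translates into `K`: if `ℓ x = ℓ s₀`
for all `x ∈ X` then `X·s₀⁻¹ ⊆ K`. [folklore] -/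
theorem map_mulRight_subset_of_label {α : Type*} (K : Subgroup G) (ℓ : G → α)
    (hℓ : ∀ x y, ℓ x = ℓ y → x * y⁻¹ ∈ K) {X : Finset G} {s₀ : G}
    (hX : ∀ x ∈ X, ℓ x = ℓ s₀) :
    ∀ y ∈ X.map (Equiv.mulRight s₀⁻¹).toEmbedding, y ∈ K := by
  intro y hy
  rw [mem_map] at hy
  obtain ⟨x, hx, rfl⟩ := hy
  exact hℓ x s₀ (hX x hx)

omit [DecidableEq G] in
/-- **Coset fibring inequality.** Let `K ≤ G`, let `ℓ` be a labelling whose fibres lie in right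
cosets of `K` (`ℓ x = ℓ y → x y⁻¹ ∈ K`), and let `B` bound the volume `|S'||T'||U'|` of every TPP
triple of subsets of `K`. Then every TPP triple `(S,T,U)` of `G` satisfies
`|S||T||U| ≤ |ℓ(S)|·|ℓ(T)|·|ℓ(U)|·B`: each fibre triple is a TPP triple (sub-triple) whose three
members translate, by right multiplication, into `K` (`TripleProductProperty.map_mulRight`). [folklore] -/
theorem tpp_card_mul_mul_le_cosets {α : Type*} [DecidableEq α] (K : Subgroup G) (ℓ : G → α)
    (hℓ : ∀ x y, ℓ x = ℓ y → x * y⁻¹ ∈ K) (B : ℕ)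
    (hK : ∀ S' T' U' : Finset G, (∀ x ∈ S', x ∈ K) → (∀ x ∈ T', x ∈ K) → (∀ x ∈ U', x ∈ K) →
      TripleProductProperty S' T' U' → S'.card * T'.card * U'.card ≤ B)
    {S T U : Finset G} (h : TripleProductProperty S T U) :
    S.card * T.card * U.card ≤ (S.image ℓ).card * (T.image ℓ).card * (U.image ℓ).card * B := by
  refine card_mul_mul_le_fibres S T U ℓ ℓ ℓ B ?_
  intro a ha b hb c hc
  rw [mem_image] at ha hb hc
  obtain ⟨s₀, hs₀, rfl⟩ := ha
  obtain ⟨t₀, ht₀, rfl⟩ := hb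
  obtain ⟨u₀, hu₀, rfl⟩ := hc
  set S' := S.filter (fun x => ℓ x = ℓ s₀) with hS'
  set T' := T.filter (fun x => ℓ x = ℓ t₀) with hT'
  set U' := U.filter (fun x => ℓ x = ℓ u₀) with hU'
  have hsub : TripleProductProperty S' T' U' :=
    h.mono (filter_subset _ _) (filter_subset _ _) (filter_subset _ _)
  have hmap := hsub.map_mulRight s₀⁻¹ t₀⁻¹ u₀⁻¹
  have hvol := hK _ _ _
    (map_mulRight_subset_of_label K ℓ hℓ (fun x hx => (mem_filter.1 hx).2))
    (map_mulRight_subset_of_label K ℓ hℓ (fun x hx => (mem_filter.1 hx).2))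
    (map_mulRight_subset_of_label K ℓ hℓ (fun x hx => (mem_filter.1 hx).2)) hmap
  simpa only [card_map] using hvol

/-- **Extension by `K`-inequivalent elements.** If `(S,T,U)` is a TPP triple of subsets of `K ≤ G` and
`R` is a set of pairwise right-`K`-inequivalent elements (`r r'⁻¹ ∈ K → r = r'`, e.g. part of a right
transversal), then `(S, T, U·R)` is a TPP triple of `G` and `|U·R| = |U|·|R|`: in
`s s'⁻¹ · t t'⁻¹ · (u r)(u' r')⁻¹ = 1` the factor `r r'⁻¹ = u⁻¹ (s s'⁻¹ t t'⁻¹)⁻¹ u'` lies in `K`, so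
`r = r'` and the relation is one of `(S,T,U)`. [folklore] -/
theorem tpp_extend (K : Subgroup G) {S T U : Finset G}
    (hS : ∀ x ∈ S, x ∈ K) (hT : ∀ x ∈ T, x ∈ K) (hU : ∀ x ∈ U, x ∈ K)
    (h : TripleProductProperty S T U) (R : Finset G)
    (hR : ∀ r ∈ R, ∀ r' ∈ R, r * r'⁻¹ ∈ K → r = r') :
    TripleProductProperty S T (image₂ (· * ·) U R) ∧ (image₂ (· * ·) U R).card = U.card * R.card := by
  constructor
  · intro s hs s' hs' t ht t' ht' w hw w' hw' he
    rw [mem_image₂] at hw hw'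
    obtain ⟨u, hu, r, hr, rfl⟩ := hw
    obtain ⟨u', hu', r', hr', rfl⟩ := hw'
    -- r r'⁻¹ ∈ K
    have hq : s * s'⁻¹ * (t * t'⁻¹) ∈ K :=
      K.mul_mem (K.mul_mem (hS s hs) (K.inv_mem (hS s' hs')))
        (K.mul_mem (hT t ht) (K.inv_mem (hT t' ht')))
    have hrr : r * r'⁻¹ = u⁻¹ * (s * s'⁻¹ * (t * t'⁻¹))⁻¹ * u' := by
      have e1 : s * s'⁻¹ * (t * t'⁻¹) * (u * r * (u' * r')⁻¹) =
          (s * s'⁻¹ * (t * t'⁻¹)) * u * (r * r'⁻¹) * u'⁻¹ := by group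
      rw [e1] at he
      calc r * r'⁻¹ = u⁻¹ * (s * s'⁻¹ * (t * t'⁻¹))⁻¹ *
            ((s * s'⁻¹ * (t * t'⁻¹)) * u * (r * r'⁻¹) * u'⁻¹) * u' := by group
        _ = u⁻¹ * (s * s'⁻¹ * (t * t'⁻¹))⁻¹ * u' := by rw [he]; group
    have hrK : r * r'⁻¹ ∈ K := by
      rw [hrr]
      exact K.mul_mem (K.mul_mem (K.inv_mem (hU u hu)) (K.inv_mem hq)) (hU u' hu')
    have hr_eq : r = r' := hR r hr r' hr' hrK
    subst hr_eq
    have he' : s * s'⁻¹ * (t * t'⁻¹) * (u * u'⁻¹) = 1 := by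
      have e2 : s * s'⁻¹ * (t * t'⁻¹) * (u * r * (u' * r)⁻¹) =
          s * s'⁻¹ * (t * t'⁻¹) * (u * u'⁻¹) := by group
      rwa [e2] at he
    obtain ⟨h1, h2, h3⟩ := h s hs s' hs' t ht t' ht' u hu u' hu' he'
    exact ⟨h1, h2, by rw [h3]⟩
  · -- injectivity of (u, r) ↦ u r on U × R
    rw [card_image₂_iff]
    rintro ⟨u, r⟩ hur ⟨u', r'⟩ hur' heq
    simp only [Set.mem_prod, mem_coe] at hur hur'
    simp only at heq
    have hrK : r * r'⁻¹ ∈ K := by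
      have : r * r'⁻¹ = u⁻¹ * u' := by
        calc r * r'⁻¹ = u⁻¹ * (u * r) * r'⁻¹ := by group
          _ = u⁻¹ * (u' * r') * r'⁻¹ := by rw [heq]
          _ = u⁻¹ * u' := by group
      rw [this]
      exact K.mul_mem (K.inv_mem (hU u hur.1)) (hU u' hur'.1)
    have hr_eq : r = r' := hR r hur.2 r' hur'.2 hrK
    subst hr_eq
    have hu_eq : u = u' := mul_right_cancel heq
    subst hu_eq
    rfl

/-! ## Transport along an injective homomorphism -/

/-- The TPP pulls back along an injective multiplicative map: if `ψ` is injective and multiplicative and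
`(A, B, C)` is a TPP triple in the target, then the pull-backs `{π | ψ π ∈ A}` etc. form a TPP triple.
[folklore] -/
theorem tpp_pullback {H : Type*} [Group H] [Fintype H] [DecidableEq H] {ψ : H →* G}
    (hψ : Function.Injective ψ) {A B C : Finset G} (h : TripleProductProperty A B C) :
    TripleProductProperty (univ.filter fun π => ψ π ∈ A) (univ.filter fun π => ψ π ∈ B)
      (univ.filter fun π => ψ π ∈ C) := by
  intro s hs s' hs' t ht t' ht' u hu u' hu' he
  simp only [mem_filter, mem_univ, true_and] at hs hs' ht ht' hu hu'
  have he' : ψ s * (ψ s')⁻¹ * (ψ t * (ψ t')⁻¹) * (ψ u * (ψ u')⁻¹) = 1 := by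
    have := congrArg ψ he
    simpa only [map_mul, map_inv, map_one] using this
  obtain ⟨h1, h2, h3⟩ := h _ hs _ hs' _ ht _ ht' _ hu _ hu' he'
  exact ⟨hψ h1, hψ h2, hψ h3⟩

omit [DecidableEq G] in
/-- The TPP pushes forward along an injective multiplicative map. [folklore] -/
theorem tpp_map {H : Type*} [Group H] [DecidableEq H] (ψ : H →* G)
    (hψ : Function.Injective ψ) {A B C : Finset H} (h : TripleProductProperty A B C) :
    TripleProductProperty (A.map ⟨ψ, hψ⟩) (B.map ⟨ψ, hψ⟩) (C.map ⟨ψ, hψ⟩) := by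
  intro s hs s' hs' t ht t' ht' u hu u' hu' he
  simp only [mem_map, Function.Embedding.coeFn_mk] at hs hs' ht ht' hu hu'
  obtain ⟨a, ha, rfl⟩ := hs
  obtain ⟨a', ha', rfl⟩ := hs'
  obtain ⟨b, hb, rfl⟩ := ht
  obtain ⟨b', hb', rfl⟩ := ht'
  obtain ⟨c, hc, rfl⟩ := hu
  obtain ⟨c', hc', rfl⟩ := hu'
  have he' : ψ (a * a'⁻¹ * (b * b'⁻¹) * (c * c'⁻¹)) = ψ 1 := by
    simpa only [map_mul, map_inv, map_one] using he
  obtain ⟨h1, h2, h3⟩ := h a ha a' ha' b hb b' hb' c hc c' hc' (hψ he')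
  exact ⟨by rw [h1], by rw [h2], by rw [h3]⟩

/-! ## The symmetric group: fibring over a point stabiliser -/

/-- Right cosets of `Stab(i₀)` in `S_n` are the fibres of `x ↦ x⁻¹ i₀`: if `x⁻¹ i₀ = y⁻¹ i₀` then
`x y⁻¹` fixes `i₀`. [folklore] -/
theorem mul_inv_mem_stabilizer_of_inv_apply_eq {n : ℕ} (i₀ : Fin n) (x y : Equiv.Perm (Fin n))
    (hxy : x⁻¹ i₀ = y⁻¹ i₀) : x * y⁻¹ ∈ MulAction.stabilizer (Equiv.Perm (Fin n)) i₀ := by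
  rw [MulAction.mem_stabilizer_iff, Equiv.Perm.smul_def, Equiv.Perm.mul_apply, ← hxy]
  simp

/-- **TPP volumes inside a point stabiliser are TPP volumes of `S_{n-1}`.** If `B` bounds `|S'||T'||U'|`
for every TPP triple of `S_{n-1}`, then it bounds the volume of every TPP triple of `S_n` all of whose
members fix `i₀` (transport `Stab(i₀) ≅ S_{n-1}` by the tree's `exists_stabiliser_transport`, pull-back
of the TPP along the injective homomorphism, `card_pullback`). [folklore] -/
theorem tpp_volume_le_of_stabilizer {n : ℕ} (i₀ : Fin n) (B : ℕ)
    (hB : ∀ S' T' U' : Finset (Equiv.Perm (Fin (n - 1))), TripleProductProperty S' T' U' →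
      S'.card * T'.card * U'.card ≤ B)
    (S T U : Finset (Equiv.Perm (Fin n)))
    (hS : ∀ x ∈ S, x ∈ MulAction.stabilizer (Equiv.Perm (Fin n)) i₀)
    (hT : ∀ x ∈ T, x ∈ MulAction.stabilizer (Equiv.Perm (Fin n)) i₀)
    (hU : ∀ x ∈ U, x ∈ MulAction.stabilizer (Equiv.Perm (Fin n)) i₀)
    (h : TripleProductProperty S T U) : S.card * T.card * U.card ≤ B := by
  classical
  obtain ⟨ψ, ι, hψ, -, -, -, hfix, hsurj⟩ :=
    exists_stabiliser_transport (n := n) (t := 1) (fun _ => i₀)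
      (fun a b _ => Subsingleton.elim a b)
  have himS : ∀ σ ∈ S, ∃ π, ψ π = σ := fun σ hσ =>
    hsurj σ (fun _ => by simpa [MulAction.mem_stabilizer_iff] using hS σ hσ)
  have himT : ∀ σ ∈ T, ∃ π, ψ π = σ := fun σ hσ =>
    hsurj σ (fun _ => by simpa [MulAction.mem_stabilizer_iff] using hT σ hσ)
  have himU : ∀ σ ∈ U, ∃ π, ψ π = σ := fun σ hσ =>
    hsurj σ (fun _ => by simpa [MulAction.mem_stabilizer_iff] using hU σ hσ)
  have htpp := tpp_pullback (ψ := ψ) hψ h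
  have hvol := hB _ _ _ htpp
  rwa [card_pullback hψ himS, card_pullback hψ himT, card_pullback hψ himU] at hvol

/-- **Point fibring in `S_n`.** For every `i₀` and every bound `B` on the volumes of TPP triples of
`S_{n-1}`, every TPP triple `(S,T,U)` of `S_n` satisfies
`|S||T||U| ≤ |{s⁻¹ i₀}|·|{t⁻¹ i₀}|·|{u⁻¹ i₀}| · B` — the numbers of DISTINCT preimages of `i₀` under the
three sets. With `B = P(S_{n-1})` the neutral value of the product is `n^{3/2}`; a triple all of whose
points have preimage-products `≥ n^{3/2}` gains nothing, a "pinched" point gains. [folklore] -/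
theorem tpp_card_mul_mul_le_pointFibres {n : ℕ} (i₀ : Fin n) (B : ℕ)
    (hB : ∀ S' T' U' : Finset (Equiv.Perm (Fin (n - 1))), TripleProductProperty S' T' U' →
      S'.card * T'.card * U'.card ≤ B)
    {S T U : Finset (Equiv.Perm (Fin n))} (h : TripleProductProperty S T U) :
    S.card * T.card * U.card ≤
      (S.image fun x => x⁻¹ i₀).card * (T.image fun x => x⁻¹ i₀).card *
        (U.image fun x => x⁻¹ i₀).card * B :=
  tpp_card_mul_mul_le_cosets (MulAction.stabilizer (Equiv.Perm (Fin n)) i₀) (fun x => x⁻¹ i₀)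
    (mul_inv_mem_stabilizer_of_inv_apply_eq i₀) B
    (fun S' T' U' hS' hT' hU' h' => tpp_volume_le_of_stabilizer i₀ B hB S' T' U' hS' hT' hU' h') h

/-- The transpositions `(i₀ k)`, `k ∈ Fin n`, are pairwise right-`Stab(i₀)`-inequivalent:
`(i₀ k)(i₀ k')⁻¹` fixes `i₀` only if `k = k'`. [folklore] -/
theorem swap_mul_swap_inv_mem_stabilizer {n : ℕ} (i₀ k k' : Fin n)
    (hk : Equiv.swap i₀ k * (Equiv.swap i₀ k')⁻¹ ∈ MulAction.stabilizer (Equiv.Perm (Fin n)) i₀) :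
    k = k' := by
  rw [MulAction.mem_stabilizer_iff, Equiv.Perm.smul_def, Equiv.swap_inv, Equiv.Perm.mul_apply,
    Equiv.swap_apply_left] at hk
  by_contra hne
  by_cases hk'i : k' = i₀
  · subst hk'i
    rw [Equiv.swap_apply_left] at hk
    exact hne hk
  · rw [Equiv.swap_apply_of_ne_of_ne hk'i (Ne.symm hne)] at hk
    exact hk'i hk

/-- **Lifting: `n · P(S_{n-1}) ≤ P(S_n)`.** Every TPP triple `(S', T', U')` of `S_{n-1}` yields a TPP
triple `(S, T, U)` of `S_n` with `|S| = |S'|`, `|T| = |T'|`, `|U| = n·|U'|`: push the triple into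
`Stab(i₀)` along the stabiliser transport and extend `U` by the right transversal `{(i₀ k) : k}`
(`tpp_extend`). [folklore] -/
theorem tpp_volume_lift {n : ℕ} (i₀ : Fin n) (S' T' U' : Finset (Equiv.Perm (Fin (n - 1))))
    (h : TripleProductProperty S' T' U') :
    ∃ S T U : Finset (Equiv.Perm (Fin n)), TripleProductProperty S T U ∧
      S.card = S'.card ∧ T.card = T'.card ∧ U.card = n * U'.card := by
  classical
  obtain ⟨ψ, ι, hψ, -, -, -, hfix, -⟩ :=
    exists_stabiliser_transport (n := n) (t := 1) (fun _ => i₀)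
      (fun a b _ => Subsingleton.elim a b)
  set K := MulAction.stabilizer (Equiv.Perm (Fin n)) i₀ with hK
  have hmem : ∀ X : Finset (Equiv.Perm (Fin (n - 1))), ∀ x ∈ X.map ⟨ψ, hψ⟩, x ∈ K := by
    intro X x hx
    rw [mem_map] at hx
    obtain ⟨π, -, rfl⟩ := hx
    rw [hK, MulAction.mem_stabilizer_iff, Equiv.Perm.smul_def]
    exact hfix π 0
  have hmap := tpp_map ψ hψ h
  set R : Finset (Equiv.Perm (Fin n)) := univ.image fun k => Equiv.swap i₀ k with hR
  have hRK : ∀ r ∈ R, ∀ r' ∈ R, r * r'⁻¹ ∈ K → r = r' := by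
    intro r hr r' hr' hrr
    rw [hR, mem_image] at hr hr'
    obtain ⟨k, -, rfl⟩ := hr
    obtain ⟨k', -, rfl⟩ := hr'
    rw [swap_mul_swap_inv_mem_stabilizer i₀ k k' hrr]
  have hRcard : R.card = n := by
    rw [hR, card_image_of_injective _ (fun k k' hkk => ?_), card_univ, Fintype.card_fin]
    have := congrArg (fun e : Equiv.Perm (Fin n) => e i₀) hkk
    simpa using this
  obtain ⟨htpp, hcard⟩ := tpp_extend K (hmem S') (hmem T') (hmem U') hmap R hRK
  refine ⟨_, _, _, htpp, card_map _, card_map _, ?_⟩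
  rw [hcard, card_map, hRcard, mul_comm]

end Summit.MatrixMultiplication.MatrixMultiplication.Theorems.PolynomialSlack
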